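import Literature.NumberTheory.Transcendental.RoySmallValueBasic
import Mathlib.Algebra.Order.Antidiag.Finsupp
import Mathlib.LinearAlgebra.Matrix.ToLinearEquiv
import Mathlib.LinearAlgebra.Matrix.Reindex
import HarnessLib

/-!
# Roy's small value estimate for `𝔾ₐ × 𝔾ₘ` — the determinant `Φ` as a universal integer polynomial

Topic `Literature/NumberTheory/Transcendental`. Part of the formalisation of the proof of Roy 2013,
Theorem 1.1 (named fact `roy2013_thm_1_1`, `RoySmallValueEstimates.lean`), seat B. Source: D. Roy,
*A small value estimate for `𝔾ₐ × 𝔾ₘ`*, Mathematika 59 (2013) 333–363 = arXiv:1301.0663, §5,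
proof of Theorem 5.2 (p. 13 of the arXiv text): with `ℂ[X]_ν = E₀P₀ ⊕ E₁P₁ ⊕ E₂P₂` as in
Lemma 5.1, "for each `Q = (Q₀, Q₁, Q₂) ∈ ℂ[X]_D³` we define a linear map
`φ_Q : E₀ × E₁ × E₂ → ℂ[X]_ν`, `(A₀, A₁, A₂) ↦ A₀Q₀ + A₁Q₁ + A₂Q₂` … the map
`Φ : Q ↦ det(M_Q)` is a multihomogeneous polynomial map".

In this development (which avoids resultants and Chow forms) `Φ` itself plays the role of Roy's
resultant `Res_D`. This file constructs it as a UNIVERSAL INTEGER POLYNOMIAL in the coefficients of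
`Q₀, Q₁, Q₂` (so that it can be specialised to `ℤ`, to number fields and to `ℂ`), for `m = 2`,
`ν = 3D`, `E₀ = ℂ[X]_{2D}` and `E₁, E₂` spanned by given sets `S₁, S₂` of monomials of degree `2D`:

* `Mon n` — the exponents of degree `n` in three variables (a `Fintype`);
* `univMatrix D S₁ S₂` — the matrix of `φ_Q` in the monomial bases, with entries in
  `ℤ[u]`, `u = (u_{k,μ})` the universal coefficients of `Q_k = ∑_μ u_{k,μ} X^μ` (`k = 0, 1, 2`,
  `|μ| = D`): the entry in row `i` (`|i| = 3D`) and column `X^ν` of block `k` is `u_{k, i-ν}` if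
  `ν ≤ i` and `0` otherwise (`= coeff_i (X^ν Q_k)`);
* `univDet D S₁ S₂ h` — its determinant after identifying rows and columns (`h`: as many columns
  as rows), an element of `ℤ[u]`;
* `phi D S₁ S₂ h Q` — its value `Φ(Q₀, Q₁, Q₂) ∈ ℂ` at complex forms `Q_k`;
  `phi_eq_det` — `Φ(Q) = det (coeff_i (X^ν Q_k))_{i, (k,ν)}`;
* `phi_eq_zero_of_common_zero` — if `Q₀, Q₁, Q₂` have a common zero `α ≠ 0` then `Φ(Q) = 0`
  (the row vector `(α^i)_i` kills every column);
* `phi_ne_zero_of_linearIndependent` — if the polynomials `X^ν Q₀ (|ν| = 2D)`, `X^ν Q₁ (ν ∈ S₁)`,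
  `X^ν Q₂ (ν ∈ S₂)` are linearly independent then `Φ(Q) ≠ 0`;
* `phi_add_smul` — along a line, `Φ(Q + zS) = Ψ(z)` for the polynomial
  `Ψ = det(M_Q + X M_S) ∈ ℂ[X]` (the entries are linear in the coefficients).

Definitions carry bodies; everything stated is proved; no named facts.

## References

* [Roy2013] D. Roy, *A small value estimate for 𝔾ₐ × 𝔾ₘ*, Mathematika 59 (2013), 333–363
  (arXiv:1301.0663), §5, Lemma 5.1 and proof of Theorem 5.2 (the maps `φ_Q`, `Φ`).
-/

noncomputable section

open MvPolynomial Finset Matrix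

namespace Literature.NumberTheory.Transcendental

namespace Roy2013

/-! ### Exponents of a given degree -/

/-- The exponents `μ ∈ ℕ³` of degree `|μ| = n` (indexing the monomials of `ℂ[X₀,X₁,X₂]_n`).
This is the same subtype as `Literature.NumberTheory.Transcendental.NguyenRoy.MonoIdx 2 n`
(`RoySmallValueEstimatesResultantProofs.lean`), redefined here (with a global `Fintype` instance)
to avoid that file's heavy import cone (Krull dimension, Nesterenko elimination); a librarian may
merge the two. It carries only the pointwise (product) partial order inherited from `Fin 3 →₀ ℕ`,
which is the order used in `univCol` (`ν ≤ i`).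
[cite: Roy2013, §2 ("basis of monomials `X^ν` with `|ν| = D`")] -/
abbrev Mon (n : ℕ) : Type := {μ : Fin 3 →₀ ℕ // μ.degree = n}

/-- `Mon n` is finite (the exponents of degree `n` supported on the three variables). [folklore] -/
instance (n : ℕ) : Fintype (Mon n) := by
  classical
  refine Fintype.subtype ((univ : Finset (Fin 3)).finsuppAntidiag n) fun μ => ?_
  rw [mem_finsuppAntidiag, Finsupp.degree_eq_sum]
  exact ⟨fun h => h.1, fun h => ⟨h, subset_univ _⟩⟩

/-- The exponent `n • e_j` has degree `n`. [folklore] -/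
theorem degree_single_smul (j : Fin 3) (n : ℕ) : (Finsupp.single j n : Fin 3 →₀ ℕ).degree = n :=
  Finsupp.degree_single j n

/-- `Mon n` is non-empty (`n • e₀`). [folklore] -/
instance (n : ℕ) : Nonempty (Mon n) := ⟨⟨Finsupp.single 0 n, degree_single_smul 0 n⟩⟩

/-- Degrees subtract along `ν ≤ i`. [folklore] -/
theorem degree_tsub_of_le {i ν : Fin 3 →₀ ℕ} (h : ν ≤ i) : (i - ν).degree = i.degree - ν.degree := by
  have : i = (i - ν) + ν := (tsub_add_cancel_of_le h).symm
  conv_rhs => rw [this, map_add]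
  omega

/-! ### The universal matrix and its determinant -/

/-- The universal coefficient ring `ℤ[u_{k,μ} : k < 3, |μ| = D]`. [cite: Roy2013, §5, proof of Thm 5.2] -/
abbrev UCoeff (D : ℕ) : Type := MvPolynomial (Fin 3 × Mon D) ℤ

/-- Column of the universal matrix attached to the monomial `X^ν` in block `k`: its entry in row
`i` is `u_{k, i-ν} = coeff_i (X^ν Q_k)` when `ν ≤ i`, and `0` otherwise.
[cite: Roy2013, §5, proof of Thm 5.2 (the matrix `M_Q`)] -/
def univCol (D : ℕ) (k : Fin 3) (ν : Fin 3 →₀ ℕ) (i : Mon (3 * D)) : UCoeff D :=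
  if h : ν ≤ i.1 ∧ (i.1 - ν).degree = D then X (k, ⟨i.1 - ν, h.2⟩) else 0

/-- The universal matrix of `φ_Q : ℂ[X]_{2D} × E₁ × E₂ → ℂ[X]_{3D}` in the monomial bases, `E₁, E₂`
spanned by the monomials with exponents in `S₁, S₂`. [cite: Roy2013, §5, proof of Thm 5.2] -/
def univMatrix (D : ℕ) (S₁ S₂ : Finset (Fin 3 →₀ ℕ)) :
    Matrix (Mon (3 * D)) (Mon (2 * D) ⊕ (S₁ ⊕ S₂)) (UCoeff D) :=
  Matrix.of fun i c => match c with
    | Sum.inl ν => univCol D 0 ν.1 i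
    | Sum.inr (Sum.inl ν) => univCol D 1 ν.1 i
    | Sum.inr (Sum.inr ν) => univCol D 2 ν.1 i

/-- The identification of columns with rows used to take the determinant (any bijection; it only
affects the sign). [folklore] -/
def colEquiv (D : ℕ) (S₁ S₂ : Finset (Fin 3 →₀ ℕ))
    (h : Fintype.card (Mon (2 * D) ⊕ (S₁ ⊕ S₂)) = Fintype.card (Mon (3 * D))) :
    Mon (2 * D) ⊕ (S₁ ⊕ S₂) ≃ Mon (3 * D) :=
  Fintype.equivOfCardEq h

/-- **The universal determinant `Φ`** as an element of `ℤ[u]`. [cite: Roy2013, §5, proof of Thm 5.2 (the map `Φ`)] -/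
def univDet (D : ℕ) (S₁ S₂ : Finset (Fin 3 →₀ ℕ))
    (h : Fintype.card (Mon (2 * D) ⊕ (S₁ ⊕ S₂)) = Fintype.card (Mon (3 * D))) : UCoeff D :=
  (Matrix.reindex (Equiv.refl _) (colEquiv D S₁ S₂ h) (univMatrix D S₁ S₂)).det

/-! ### Specialisation to complex forms -/

/-- The evaluation of the universal coefficients at the coefficients of three complex polynomials.
[cite: Roy2013, §5, proof of Thm 5.2] -/
def coeffEval (D : ℕ) (Q : Fin 3 → CX) : UCoeff D →+* ℂ :=
  eval₂Hom (Int.castRingHom ℂ) fun v => coeff v.2.1 (Q v.1)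

/-- **`Φ(Q₀, Q₁, Q₂)`** for complex forms. [cite: Roy2013, §5, proof of Thm 5.2] -/
def phi (D : ℕ) (S₁ S₂ : Finset (Fin 3 →₀ ℕ))
    (h : Fintype.card (Mon (2 * D) ⊕ (S₁ ⊕ S₂)) = Fintype.card (Mon (3 * D))) (Q : Fin 3 → CX) : ℂ :=
  coeffEval D Q (univDet D S₁ S₂ h)

/-- The complex matrix `M_Q`: entry `coeff_i (X^ν Q_k)`. [cite: Roy2013, §5, proof of Thm 5.2] -/
def cMatrix (D : ℕ) (S₁ S₂ : Finset (Fin 3 →₀ ℕ)) (Q : Fin 3 → CX) :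
    Matrix (Mon (3 * D)) (Mon (2 * D) ⊕ (S₁ ⊕ S₂)) ℂ :=
  Matrix.of fun i c => match c with
    | Sum.inl ν => coeff i.1 (monomial ν.1 1 * Q 0)
    | Sum.inr (Sum.inl ν) => coeff i.1 (monomial ν.1 1 * Q 1)
    | Sum.inr (Sum.inr ν) => coeff i.1 (monomial ν.1 1 * Q 2)

/-- Evaluating a universal column gives `coeff_i (X^ν Q_k)`, for `Q_k` homogeneous of degree `D`.
[cite: Roy2013, §5, proof of Thm 5.2] -/
theorem coeffEval_univCol {D : ℕ} {Q : Fin 3 → CX} (hQ : ∀ k, (Q k).IsHomogeneous D) (k : Fin 3)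
    (ν : Fin 3 →₀ ℕ) (i : Mon (3 * D)) :
    coeffEval D Q (univCol D k ν i) = coeff i.1 (monomial ν 1 * Q k) := by
  classical
  unfold univCol coeffEval
  rw [coeff_monomial_mul']
  by_cases hle : ν ≤ i.1
  · rw [if_pos hle, one_mul]
    by_cases hdeg : (i.1 - ν).degree = D
    · rw [dif_pos ⟨hle, hdeg⟩, coe_eval₂Hom, eval₂_X]
    · rw [dif_neg (fun h => hdeg h.2), map_zero]
      exact ((hQ k).coeff_eq_zero hdeg).symm
  · rw [if_neg hle, dif_neg (fun h => hle h.1), map_zero]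

/-- Under `coeffEval`, the universal matrix becomes `M_Q`. [cite: Roy2013, §5, proof of Thm 5.2] -/
theorem map_univMatrix {D : ℕ} (S₁ S₂ : Finset (Fin 3 →₀ ℕ)) {Q : Fin 3 → CX}
    (hQ : ∀ k, (Q k).IsHomogeneous D) :
    (univMatrix D S₁ S₂).map (coeffEval D Q) = cMatrix D S₁ S₂ Q := by
  ext i c
  rw [Matrix.map_apply]
  rcases c with ν | ν | ν <;>
    simp only [univMatrix, cMatrix, Matrix.of_apply, coeffEval_univCol hQ]

/-- **`Φ(Q) = det M_Q`.** [cite: Roy2013, §5, proof of Thm 5.2] -/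
theorem phi_eq_det {D : ℕ} (S₁ S₂ : Finset (Fin 3 →₀ ℕ))
    (h : Fintype.card (Mon (2 * D) ⊕ (S₁ ⊕ S₂)) = Fintype.card (Mon (3 * D)))
    {Q : Fin 3 → CX} (hQ : ∀ k, (Q k).IsHomogeneous D) :
    phi D S₁ S₂ h Q =
      (Matrix.reindex (Equiv.refl _) (colEquiv D S₁ S₂ h) (cMatrix D S₁ S₂ Q)).det := by
  unfold phi univDet
  rw [RingHom.map_det, RingHom.mapMatrix_apply, reindex_apply, reindex_apply, ← submatrix_map,
    map_univMatrix S₁ S₂ hQ]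

/-! ### Values of forms of degree `n` from their coefficients on `Mon n` -/

/-- For a form `f` of degree `n`, `f(α) = ∑_{|i| = n} coeff_i(f) α^i`. [folklore] -/
theorem aeval_eq_sum_mon {f : CX} {n : ℕ} (hf : f.IsHomogeneous n) (α : Fin 3 → ℂ) :
    aeval α f = ∑ i : Mon n, coeff i.1 f * ∏ j, α j ^ i.1 j := by
  classical
  rw [show aeval α f = eval α f from rfl, eval_eq']
  symm
  rw [← Finset.sum_subtype ((univ : Finset (Fin 3)).finsuppAntidiag n) (fun μ => by
    rw [mem_finsuppAntidiag, Finsupp.degree_eq_sum]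
    exact ⟨fun h => h.1, fun h => ⟨h, subset_univ _⟩⟩)
    (fun d : Fin 3 →₀ ℕ => coeff d f * ∏ j, α j ^ d j)]
  refine (Finset.sum_subset (fun d hd => ?_) fun d _ hd => ?_).symm
  · rw [mem_finsuppAntidiag]
    refine ⟨?_, subset_univ _⟩
    rw [← Finsupp.degree_eq_sum, Finsupp.degree_apply]
    exact (hf.degree_eq_sum_deg_support hd).symm
  · rw [notMem_support_iff.mp hd, zero_mul]

/-! ### A common zero kills `Φ` -/

/-- The monomial values `α^i`, `|i| = 3D`, pair to zero with the coefficient vector of a form of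
degree `3D` vanishing at `α`. [folklore] -/
theorem sum_monomialValues_mul_coeff_eq_zero {n : ℕ} {g : CX} (hg : g.IsHomogeneous n)
    {α : Fin 3 → ℂ} (hzero : aeval α g = 0) :
    ∑ i : Mon n, (∏ j, α j ^ i.1 j) * coeff i.1 g = 0 := by
  rw [aeval_eq_sum_mon hg] at hzero
  rw [← hzero]
  exact Finset.sum_congr rfl fun i _ => mul_comm _ _

/-- The columns of `M_Q` are coefficient vectors of forms of degree `3D`. [cite: Roy2013, §5, proof of Thm 5.2] -/
theorem isHomogeneous_monomial_mul {D : ℕ} {ν : Fin 3 →₀ ℕ} (hν : ν.degree = 2 * D) {q : CX}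
    (hq : q.IsHomogeneous D) : (monomial ν (1 : ℂ) * q).IsHomogeneous (3 * D) := by
  have h := (isHomogeneous_monomial (1 : ℂ) hν).mul hq
  rwa [show 2 * D + D = 3 * D by ring] at h

/-- **If `Q₀, Q₁, Q₂` have a common zero `α ≠ 0`, then `Φ(Q) = 0`**: the row vector `(α^i)_{|i|=3D}`
is a non-zero element of the left kernel of `M_Q` (each column is the coefficient vector of some
`X^ν Q_k`, whose value at `α` is `0`). This is the elementary half of "`Res_D(P₀,P₁,P₂) = 0` iff
the `Pᵢ` have a common zero" for `Φ`. [cite: Roy2013, §2 (zeros of Chow forms) and §5 proof of Thm 5.2] -/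
theorem phi_eq_zero_of_common_zero {D : ℕ} {S₁ S₂ : Finset (Fin 3 →₀ ℕ)}
    (hS₁ : ∀ ν ∈ S₁, ν.degree = 2 * D) (hS₂ : ∀ ν ∈ S₂, ν.degree = 2 * D)
    (h : Fintype.card (Mon (2 * D) ⊕ (S₁ ⊕ S₂)) = Fintype.card (Mon (3 * D)))
    {Q : Fin 3 → CX} (hQ : ∀ k, (Q k).IsHomogeneous D) {α : Fin 3 → ℂ} (hα : α ≠ 0)
    (hzero : ∀ k, aeval α (Q k) = 0) : phi D S₁ S₂ h Q = 0 := by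
  classical
  rw [phi_eq_det S₁ S₂ h hQ]
  set w : Mon (3 * D) → ℂ := fun i => ∏ j, α j ^ i.1 j with hw
  -- `w ≠ 0`
  have hw0 : w ≠ 0 := by
    obtain ⟨j, hj⟩ := Function.ne_iff.mp hα
    rw [Pi.zero_apply] at hj
    have hval : w ⟨Finsupp.single j (3 * D), degree_single_smul j _⟩ = α j ^ (3 * D) := by
      simp only [hw]
      rw [Finset.prod_eq_single j (fun b _ hb => ?_) (fun hj' => absurd (mem_univ j) hj')]
      · rw [Finsupp.single_apply, if_pos rfl]
      · rw [Finsupp.single_apply, if_neg (Ne.symm hb), pow_zero]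
    intro h0
    have := congr_fun h0 ⟨Finsupp.single j (3 * D), degree_single_smul j _⟩
    rw [hval] at this
    exact pow_ne_zero _ hj this
  -- `w M_Q = 0`
  refine Matrix.exists_vecMul_eq_zero_iff.mp ⟨w, hw0, funext fun c => ?_⟩
  rw [Pi.zero_apply, Matrix.vecMul, dotProduct]
  simp only [reindex_apply, submatrix_apply, Equiv.refl_symm, Equiv.coe_refl, id]
  rcases (colEquiv D S₁ S₂ h).symm c with ν | ν | ν
  · exact sum_monomialValues_mul_coeff_eq_zero (isHomogeneous_monomial_mul ν.2 (hQ 0))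
      (by rw [map_mul, hzero 0, mul_zero])
  · exact sum_monomialValues_mul_coeff_eq_zero (isHomogeneous_monomial_mul (hS₁ ν ν.2) (hQ 1))
      (by rw [map_mul, hzero 1, mul_zero])
  · exact sum_monomialValues_mul_coeff_eq_zero (isHomogeneous_monomial_mul (hS₂ ν ν.2) (hQ 2))
      (by rw [map_mul, hzero 2, mul_zero])

/-! ### Linear independence of the columns gives `Φ ≠ 0` -/

/-- The family of polynomials whose coefficient vectors are the columns of `M_Q`:
`X^ν Q₀ (|ν| = 2D)`, `X^ν Q₁ (ν ∈ S₁)`, `X^ν Q₂ (ν ∈ S₂)`. [cite: Roy2013, §5, proof of Thm 5.2] -/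
def colFamily (D : ℕ) (S₁ S₂ : Finset (Fin 3 →₀ ℕ)) (Q : Fin 3 → CX) :
    Mon (2 * D) ⊕ (S₁ ⊕ S₂) → CX := fun c => match c with
  | Sum.inl ν => monomial ν.1 1 * Q 0
  | Sum.inr (Sum.inl ν) => monomial ν.1 1 * Q 1
  | Sum.inr (Sum.inr ν) => monomial ν.1 1 * Q 2

/-- The entries of `M_Q` are the coefficients of the column family. [cite: Roy2013, §5, proof of Thm 5.2] -/
theorem cMatrix_apply {D : ℕ} (S₁ S₂ : Finset (Fin 3 →₀ ℕ)) (Q : Fin 3 → CX) (i : Mon (3 * D))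
    (c : Mon (2 * D) ⊕ (S₁ ⊕ S₂)) : cMatrix D S₁ S₂ Q i c = coeff i.1 (colFamily D S₁ S₂ Q c) := by
  rcases c with ν | ν | ν <;> rfl

/-- The column family consists of forms of degree `3D`. [cite: Roy2013, §5, proof of Thm 5.2] -/
theorem isHomogeneous_colFamily {D : ℕ} {S₁ S₂ : Finset (Fin 3 →₀ ℕ)}
    (hS₁ : ∀ ν ∈ S₁, ν.degree = 2 * D) (hS₂ : ∀ ν ∈ S₂, ν.degree = 2 * D)
    {Q : Fin 3 → CX} (hQ : ∀ k, (Q k).IsHomogeneous D) (c : Mon (2 * D) ⊕ (S₁ ⊕ S₂)) :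
    (colFamily D S₁ S₂ Q c).IsHomogeneous (3 * D) := by
  rcases c with ν | ν | ν
  · exact isHomogeneous_monomial_mul ν.2 (hQ 0)
  · exact isHomogeneous_monomial_mul (hS₁ ν ν.2) (hQ 1)
  · exact isHomogeneous_monomial_mul (hS₂ ν ν.2) (hQ 2)

/-- A form of degree `n` all of whose coefficients on `Mon n` vanish is zero. [folklore] -/
theorem eq_zero_of_coeff_mon_eq_zero {n : ℕ} {g : CX} (hg : g.IsHomogeneous n)
    (h : ∀ i : Mon n, coeff i.1 g = 0) : g = 0 := by
  ext d
  rw [coeff_zero]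
  by_cases hd : d.degree = n
  · exact h ⟨d, hd⟩
  · exact hg.coeff_eq_zero hd

/-- **Linear independence of `X^ν Q₀ (|ν| = 2D), X^ν Q₁ (ν ∈ S₁), X^ν Q₂ (ν ∈ S₂)` gives
`Φ(Q) ≠ 0`.** (Roy: for the regular sequence defining `E₀, E₁, E₂`, `φ_P` is an isomorphism, so
`Φ(P) ≠ 0`.) [cite: Roy2013, §5, proof of Thm 5.2] -/
theorem phi_ne_zero_of_linearIndependent {D : ℕ} {S₁ S₂ : Finset (Fin 3 →₀ ℕ)}
    (hS₁ : ∀ ν ∈ S₁, ν.degree = 2 * D) (hS₂ : ∀ ν ∈ S₂, ν.degree = 2 * D)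
    (h : Fintype.card (Mon (2 * D) ⊕ (S₁ ⊕ S₂)) = Fintype.card (Mon (3 * D)))
    {Q : Fin 3 → CX} (hQ : ∀ k, (Q k).IsHomogeneous D)
    (hli : LinearIndependent ℂ (colFamily D S₁ S₂ Q)) : phi D S₁ S₂ h Q ≠ 0 := by
  classical
  rw [phi_eq_det S₁ S₂ h hQ]
  intro hdet
  obtain ⟨v, hv0, hv⟩ := Matrix.exists_mulVec_eq_zero_iff.mpr hdet
  set e := colEquiv D S₁ S₂ h with he
  -- the polynomial `g = ∑_c v(e c) • fam c` has all coefficients on `Mon 3D` equal to zero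
  set g : CX := ∑ c, C (v (e c)) * colFamily D S₁ S₂ Q c with hgdef
  have hcoeff : ∀ i : Mon (3 * D), coeff i.1 g = 0 := by
    intro i
    have hi := congr_fun hv i
    rw [Pi.zero_apply, Matrix.mulVec, dotProduct] at hi
    simp only [reindex_apply, submatrix_apply, Equiv.refl_symm, Equiv.coe_refl, id] at hi
    rw [hgdef, coeff_sum]
    simp_rw [coeff_C_mul]
    rw [← hi, ← e.sum_comp]
    refine Finset.sum_congr rfl fun c _ => ?_
    rw [cMatrix_apply, Equiv.symm_apply_apply, mul_comm]
  have hg : g = 0 := eq_zero_of_coeff_mon_eq_zero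
    (IsHomogeneous.sum _ _ _ fun c _ => (isHomogeneous_colFamily hS₁ hS₂ hQ c).C_mul _) hcoeff
  -- linear independence: all `v (e c) = 0`
  have hv' : ∀ c, v (e c) = 0 := by
    refine (Fintype.linearIndependent_iff.mp hli) (fun c => v (e c)) ?_
    rw [← hg, hgdef]
    exact Finset.sum_congr rfl fun c _ => (smul_eq_C_mul _ _)
  apply hv0
  funext i
  rw [Pi.zero_apply, ← e.apply_symm_apply i]
  exact hv' _

/-! ### `Φ` along a line -/

/-- `M_{Q + zS} = M_Q + z M_S` (the entries are linear in the coefficients).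
[cite: Roy2013, §5, proof of Thm 5.2] -/
theorem cMatrix_add_smul {D : ℕ} (S₁ S₂ : Finset (Fin 3 →₀ ℕ)) (Q S : Fin 3 → CX) (z : ℂ) :
    cMatrix D S₁ S₂ (Q + z • S) = cMatrix D S₁ S₂ Q + z • cMatrix D S₁ S₂ S := by
  ext i c
  rw [Matrix.add_apply, Matrix.smul_apply, smul_eq_mul]
  rcases c with ν | ν | ν <;>
    simp only [cMatrix, Matrix.of_apply, Pi.add_apply, Pi.smul_apply, mul_add, coeff_add,
      mul_smul_comm, coeff_smul, smul_eq_mul]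

/-- The polynomial `Ψ_{Q,S} = det (M_Q + X M_S) ∈ ℂ[X]` restricting `Φ` to the line `z ↦ Q + zS`.
[cite: Roy2013, §6, proof of Prop. 6.1 (the polynomial `f(z)`)] -/
def linePoly (D : ℕ) (S₁ S₂ : Finset (Fin 3 →₀ ℕ))
    (h : Fintype.card (Mon (2 * D) ⊕ (S₁ ⊕ S₂)) = Fintype.card (Mon (3 * D))) (Q S : Fin 3 → CX) :
    Polynomial ℂ :=
  ((Matrix.reindex (Equiv.refl _) (colEquiv D S₁ S₂ h) (cMatrix D S₁ S₂ Q)).map Polynomial.C +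
    (Polynomial.X : Polynomial ℂ) •
      (Matrix.reindex (Equiv.refl _) (colEquiv D S₁ S₂ h) (cMatrix D S₁ S₂ S)).map Polynomial.C).det

/-- **`Φ(Q + zS) = Ψ_{Q,S}(z)`** for forms `Q_k, S_k` of degree `D`.
[cite: Roy2013, §6, proof of Prop. 6.1 (the polynomial `f(z)`)] -/
theorem phi_add_smul {D : ℕ} (S₁ S₂ : Finset (Fin 3 →₀ ℕ))
    (h : Fintype.card (Mon (2 * D) ⊕ (S₁ ⊕ S₂)) = Fintype.card (Mon (3 * D)))
    {Q S : Fin 3 → CX} (hQ : ∀ k, (Q k).IsHomogeneous D) (hS : ∀ k, (S k).IsHomogeneous D) (z : ℂ) :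
    phi D S₁ S₂ h (Q + z • S) = (linePoly D S₁ S₂ h Q S).eval z := by
  have hQS : ∀ k, ((Q + z • S) k).IsHomogeneous D := fun k => by
    rw [Pi.add_apply, Pi.smul_apply, smul_eq_C_mul]
    exact (hQ k).add ((hS k).C_mul z)
  rw [phi_eq_det S₁ S₂ h hQS, cMatrix_add_smul, linePoly, ← Polynomial.coe_evalRingHom,
    RingHom.map_det, RingHom.mapMatrix_apply]
  congr 1
  ext i j
  simp only [reindex_apply, submatrix_apply, Matrix.map_apply, Matrix.add_apply, Matrix.smul_apply,
    smul_eq_mul, Polynomial.coe_evalRingHom, Polynomial.eval_add, Polynomial.eval_C,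
    Polynomial.eval_mul, Polynomial.eval_X]

/-- Consequently, if `Ψ_{Q,S} = X^T Ψ₁`, then `Φ(Q + zS) = z^T Ψ₁(z)`. [folklore] -/
theorem phi_add_smul_of_dvd {D : ℕ} (S₁ S₂ : Finset (Fin 3 →₀ ℕ))
    (h : Fintype.card (Mon (2 * D) ⊕ (S₁ ⊕ S₂)) = Fintype.card (Mon (3 * D)))
    {Q S : Fin 3 → CX} (hQ : ∀ k, (Q k).IsHomogeneous D) (hS : ∀ k, (S k).IsHomogeneous D)
    {T : ℕ} {Ψ₁ : Polynomial ℂ} (hΨ : linePoly D S₁ S₂ h Q S = Polynomial.X ^ T * Ψ₁) (z : ℂ) :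
    phi D S₁ S₂ h (Q + z • S) = z ^ T * Ψ₁.eval z := by
  rw [phi_add_smul S₁ S₂ h hQ hS, hΨ, Polynomial.eval_mul, Polynomial.eval_pow, Polynomial.eval_X]

end Roy2013

end Literature.NumberTheory.Transcendental
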